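import Summits.CriticalPhenomena.SAWScalingLimit.Theorems.SAWLoopFugacityFlowAvoidanceLimitInwardManeuver
import Literature.Probability.LatticeModels.WeakBeurlingEstimate
import Literature.Probability.LatticeModels.EdgeKilledBeurling
import Literature.Probability.LatticeModels.KilledWalkHubFactorisation
import HarnessLib

/-!
# Multi-scale inward Beurling for the edge-killed walk (line `symplectic-fermion-anchor`,
crux `SAWLoopFugacityFlow.AvoidanceLimit`, stmt-CriticalPhenomena-10649, stubs W9
`hitProb_le_mul_hitProb_of_boundary`, `edgeKilled_hitProb_inner_le_pow`)

The inward twin of `JordanDomain.edgeKilled_survive_le_pow` (`EdgeKilledBeurling.lean`): the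
one-scale inward annulus maneuver `edgeKilled_hitProb_inner_le`
(`SAWLoopFugacityFlowAvoidanceLimitInwardManeuver.lean`) iterated over the scales
`k, 5k, 5²k, …` with the analytic strong Markov property for hitting probabilities of the
edge-killed walk (the walk on `ℤ²` along the edges of `Gr`, killed at its first non-`Gr` step and
on leaving the finite region `Λ`; `hitProb Gr Λ B = killedHarmExt Gr (Λ ∖ B) 𝟙_B`):

* `hitProb_le_mul_hitProb_of_boundary` — for `B₀ ⊆ B₁` and `0 ≤ M`, if `hitProb_{B₀} ≤ M` at the
  sites of `B₁` in the outer boundary of `Λ ∖ B₁` for the killed walk, then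
  `hitProb_{B₀} ≤ M · hitProb_{B₁}` off `B₁` (comparison principle on `Λ ∖ B₁`: both sides are
  killed-harmonic there, on the boundary layer of `B₁` it is the hypothesis since `hitProb_{B₁} = 1`,
  and off `Λ` the left side vanishes);
* `edgeKilled_hitProb_inner_le_pow` — if a boundary point `p ∈ ∂D` of the Jordan domain `D` lies in
  the open box of radius `12k` about `c` on `δℤ²`, then off the box of radius `24·5^J k` the
  edge-killed walk of `Ω^δ` killed on leaving `Λ` hits `mB c k` with probability at most
  `(1 - cin)^(J+1)`: induction on `J`, the step combining the one-scale estimate for the box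
  `mB c (5^(J+1) k)` with the induction hypothesis on its boundary layer (which lies off the box of
  radius `24·5^J k`) through `hitProb_le_mul_hitProb_of_boundary` — the weak Beurling estimate
  `P ≤ const·(r/R)^β`, `β = -log(1-cin)/log 5`, read from the outside in.

Everything is proved; no definitions. [cite: Smirnov2010, Lemma B.2; Chelkak2016, Lemma 2.11]
-/

noncomputable section

open scoped BigOperators Classical
open Set SimpleGraph
open Literature.Probability.LatticeModels
open Literature.Probability.RandomPlanarGeometry (JordanDomain)

namespace Summit.CriticalPhenomena.SAWScalingLimit.Theorems.AvoidanceLimit.Anchor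

/-! ### Comparison of hitting probabilities through the boundary layer -/

/-- **Analytic strong Markov property for hitting probabilities, boundary-layer form.** For the
edge-killed walk `Gr` in the finite region `Λ`, sets `B₀ ⊆ B₁` and `0 ≤ M`: if
`hitProb Gr Λ B₀ w ≤ M` for every `w ∈ B₁` in the outer boundary of `Λ ∖ B₁` for the killed walk,
then `hitProb Gr Λ B₀ x ≤ M · hitProb Gr Λ B₁ x` for every `x ∉ B₁` — on `Λ ∖ B₁` by the comparison
principle (`hitProb_{B₀}` is killed-harmonic on `Λ ∖ B₀ ⊇ Λ ∖ B₁`, `M · hitProb_{B₁}` is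
killed-harmonic on `Λ ∖ B₁`; on the outer boundary of `Λ ∖ B₁` the inequality is the hypothesis at
the sites of `B₁`, where `hitProb_{B₁} = 1`, and off `Λ` the left side is `0 ≤ M · hitProb_{B₁}`);
off `Λ` both sides vanish. [cite: Chelkak2016, §3.2] -/
theorem hitProb_le_mul_hitProb_of_boundary :
    ∀ (Gr : SimpleGraph (Site 2)) (Λ B₀ B₁ : Set (Site 2)), Λ.Finite → B₀ ⊆ B₁ →
      ∀ (M : ℝ), 0 ≤ M →
      (∀ w ∈ B₁, w ∈ killedOuterBoundary Gr (Λ \ B₁) → hitProb Gr Λ B₀ w ≤ M) →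
      ∀ x : Site 2, x ∉ B₁ → hitProb Gr Λ B₀ x ≤ M * hitProb Gr Λ B₁ x := by
  intro Gr Λ B₀ B₁ hΛ h01 M hM0 hM x hxB
  have hSfin : (Λ \ B₁).Finite := hΛ.subset fun _ hz => hz.1
  -- on the outer boundary of `Λ ∖ B₁`: in `B₁` the hypothesis (`hitProb_{B₁} = 1`), off `Λ` the
  -- left side is `0`
  have hbd : ∀ z ∈ killedOuterBoundary Gr (Λ \ B₁), hitProb Gr Λ B₀ z ≤ M * hitProb Gr Λ B₁ z := by
    intro z hz
    by_cases hzB : z ∈ B₁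
    · rw [hitProb_of_mem hzB, mul_one]; exact hM z hzB hz
    · have hzΛ : z ∉ Λ := fun h => hz.1 ⟨h, hzB⟩
      rw [hitProb_of_not_mem (fun h => hzΛ h.1), if_neg (fun h => hzB (h01 h))]
      exact mul_nonneg hM0 (hitProb_nonneg hΛ z)
  by_cases hx : x ∈ Λ \ B₁
  · -- `hitProb_{B₀}` is killed-harmonic on `Λ ∖ B₀ ⊇ Λ ∖ B₁`
    have h1 : IsKilledHarmonicOn Gr (hitProb Gr Λ B₀) (Λ \ B₁) :=
      (hitProb_harmonicOn hΛ).mono fun z hz => ⟨hz.1, fun h => hz.2 (h01 h)⟩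
    -- `M · hitProb_{B₁}` is killed-harmonic on `Λ ∖ B₁`
    have h2 : IsKilledHarmonicOn Gr (fun z => M * hitProb Gr Λ B₁ z) (Λ \ B₁) :=
      (hitProb_harmonicOn hΛ).const_mul M
    exact le_of_killedSub_killedSuper_of_boundary hSfin h1.subharmonicOn h2.superharmonicOn hbd x hx
  · have hxΛ : x ∉ Λ := fun h => hx ⟨h, hxB⟩
    rw [hitProb_of_not_mem (fun h => hxΛ h.1), if_neg (fun h => hxB (h01 h))]
    exact mul_nonneg hM0 (hitProb_nonneg hΛ x)

/-! ### The boxes of consecutive scales -/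

/-- The start boxes are monotone in the scale: `mB c k ⊆ mB c k'` for `k ≤ k'`. [folklore] -/
theorem mB_subset_mB_of_le (c : Site 2) {k k' : ℕ} (hkk' : k ≤ k') : mB c k ⊆ mB c k' := by
  rintro x ⟨h0, h1⟩
  have h : (12 : ℤ) * k ≤ 12 * k' := by exact_mod_cast Nat.mul_le_mul_left 12 hkk'
  exact ⟨h0.trans h, h1.trans h⟩

/-- The start box `mB c K` (radius `12K`) lies in the box `sqBox c (24K)`. [folklore] -/
theorem mB_subset_sqBox_two_mul (c : Site 2) (K : ℕ) : mB c K ⊆ WeakBeurling.sqBox c (24 * K) := by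
  rintro x ⟨h0, h1⟩
  rw [WeakBeurling.mem_sqBox]
  constructor <;> omega

/-- **The boundary layer of the next scale lies off the previous box.** A site in the outer
boundary of `Λ ∖ mB c (5^(J+1) k)` for the killed walk has a lattice neighbour off
`mB c (5^(J+1) k)`, hence lies at sup-distance `≥ 12·5^(J+1) k = 60·5^J k > 24·5^J k` from `c`
(`k ≥ 1`), i.e. off `sqBox c (24·5^J k)`. [folklore] -/
theorem not_mem_sqBox_of_mem_killedOuterBoundary_mB {Gr : SimpleGraph (Site 2)} {Λ : Set (Site 2)}
    (c : Site 2) {k : ℕ} (hk : 0 < k) (J : ℕ) {w : Site 2}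
    (hw : w ∈ killedOuterBoundary Gr (Λ \ mB c (5 ^ (J + 1) * k))) :
    w ∉ WeakBeurling.sqBox c (24 * 5 ^ J * k) := by
  obtain ⟨-, v, hv, e, rfl, -⟩ := hw
  have hv2 : v ∉ mB c (5 ^ (J + 1) * k) := hv.2
  have he0 := SRW.abs_stepVec_apply_le e 0
  have he1 := SRW.abs_stepVec_apply_le e 1
  simp only [mB, Set.mem_setOf_eq, not_and_or, not_le] at hv2
  rw [WeakBeurling.mem_sqBox, not_and_or, not_le, not_le]
  simp only [Pi.add_apply]
  have e1 : ((5 ^ (J + 1) * k : ℕ) : ℤ) = 5 * ((5 : ℤ) ^ J * k) := by push_cast; ring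
  have e2 : (24 : ℤ) * 5 ^ J * k = 24 * ((5 : ℤ) ^ J * k) := by ring
  have hm : (0 : ℤ) < (5 : ℤ) ^ J * k := by positivity
  rw [e1] at hv2
  rw [e2]
  generalize (5 : ℤ) ^ J * (k : ℤ) = m at hv2 hm ⊢
  rw [abs_le] at he0 he1
  rcases hv2 with h | h <;> rw [lt_abs] at h
  · left; rw [lt_abs]; rcases h with h | h <;> [left; right] <;> omega
  · right; rw [lt_abs]; rcases h with h | h <;> [left; right] <;> omega

/-! ### Multi-scale inward Beurling -/

/-- **Multi-scale inward Beurling for the edge-killed walk.** There is a universal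
`0 < cin ≤ 1` such that for every Jordan domain `D`, mesh `δ > 0`, boundary point `p ∈ ∂D` in the
open box of radius `12k` about `c` (read on `δℤ²`, `k ≥ 1`), every `J`, finite region `Λ` and site
`x` off the box of radius `24·5^J k` about `c`, the walk along the kept edges of `Ω^δ`, killed at its
first non-kept step and on leaving `Λ`, hits the box `mB c k` of radius `12k` with probability at
most `(1 - cin)^(J+1)`. Induction on `J` over the scales `5^J k`: the one-scale estimate
`edgeKilled_hitProb_inner_le` for the box `mB c (5^(J+1) k)` (the boundary point lies in its open
`12·5^(J+1) k`-box as well), the induction hypothesis on the boundary layer of that box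
(`not_mem_sqBox_of_mem_killedOuterBoundary_mB`), and the strong Markov comparison
`hitProb_le_mul_hitProb_of_boundary`. [cite: Smirnov2010, Lemma B.2; Chelkak2016, Lemma 2.11] -/
theorem edgeKilled_hitProb_inner_le_pow :
    ∃ cin : ℝ, 0 < cin ∧ cin ≤ 1 ∧ ∀ (D : JordanDomain) (δ : ℝ), 0 < δ → ∀ p ∈ frontier D.carrier,
      ∀ (c : Site 2) (k : ℕ), 0 < k → |p.re / δ - c 0| < 12 * k → |p.im / δ - c 1| < 12 * k →
      ∀ (J : ℕ) (Λ : Set (Site 2)), Λ.Finite → ∀ x : Site 2, x ∉ WeakBeurling.sqBox c (24 * 5 ^ J * k) →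
        hitProb (discreteDomainGraph D.carrier δ) Λ (mB c k) x ≤ (1 - cin) ^ (J + 1) := by
  obtain ⟨c₀, hc₀, hone⟩ := edgeKilled_hitProb_inner_le
  refine ⟨min c₀ (1 / 2), lt_min hc₀ (by norm_num), (min_le_right _ _).trans (by norm_num), ?_⟩
  intro D δ hδ p hp c k hk hp0 hp1 J
  set G := discreteDomainGraph D.carrier δ
  have hq0 : (0 : ℝ) ≤ 1 - min c₀ (1 / 2) := by
    have := min_le_right c₀ (1 / 2); linarith
  have hq1 : 1 - c₀ ≤ 1 - min c₀ (1 / 2) := by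
    have := min_le_left c₀ (1 / 2); linarith
  -- the one-scale estimate at the scale `5 ^ n * k`
  have hscale : ∀ (n : ℕ) (Λ : Set (Site 2)), Λ.Finite → ∀ x : Site 2,
      x ∉ WeakBeurling.sqBox c (24 * 5 ^ n * k) →
        hitProb G Λ (mB c (5 ^ n * k)) x ≤ 1 - min c₀ (1 / 2) := by
    intro n Λ hΛ x hx
    have h5n : 0 < 5 ^ n := Nat.pow_pos (by norm_num)
    have hkn : 0 < 5 ^ n * k := Nat.mul_pos h5n hk
    have hkn' : (k : ℝ) ≤ ((5 ^ n * k : ℕ) : ℝ) := by exact_mod_cast Nat.le_mul_of_pos_left k h5n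
    refine (hone D δ hδ p hp c (5 ^ n * k) hkn (hp0.trans_le (by linarith)) (hp1.trans_le (by linarith))
      Λ hΛ x ?_).trans hq1
    have e : (24 : ℤ) * ((5 ^ n * k : ℕ) : ℤ) = 24 * 5 ^ n * k := by push_cast; ring
    rwa [e]
  induction J with
  | zero =>
    intro Λ hΛ x hx
    have h := hscale 0 Λ hΛ x hx
    rw [pow_zero, one_mul] at h
    rwa [zero_add, pow_one]
  | succ J ih =>
    intro Λ hΛ x hx
    -- the induction hypothesis on the boundary layer of `mB c (5^(J+1) k)`
    have hM : ∀ w ∈ mB c (5 ^ (J + 1) * k), w ∈ killedOuterBoundary G (Λ \ mB c (5 ^ (J + 1) * k)) →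
        hitProb G Λ (mB c k) w ≤ (1 - min c₀ (1 / 2)) ^ (J + 1) := fun w _ hw =>
      ih Λ hΛ w (not_mem_sqBox_of_mem_killedOuterBoundary_mB c hk J hw)
    have hsub : mB c k ⊆ mB c (5 ^ (J + 1) * k) :=
      mB_subset_mB_of_le c (Nat.le_mul_of_pos_left k (Nat.pow_pos (by norm_num)))
    have hxB : x ∉ mB c (5 ^ (J + 1) * k) := by
      intro h
      have h' := mB_subset_sqBox_two_mul c (5 ^ (J + 1) * k) h
      have e : (24 : ℤ) * ((5 ^ (J + 1) * k : ℕ) : ℤ) = 24 * 5 ^ (J + 1) * k := by push_cast; ring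
      rw [e] at h'
      exact hx h'
    have key := hitProb_le_mul_hitProb_of_boundary G Λ (mB c k) (mB c (5 ^ (J + 1) * k)) hΛ hsub _
      (pow_nonneg hq0 (J + 1)) hM x hxB
    calc hitProb G Λ (mB c k) x
        ≤ (1 - min c₀ (1 / 2)) ^ (J + 1) * hitProb G Λ (mB c (5 ^ (J + 1) * k)) x := key
      _ ≤ (1 - min c₀ (1 / 2)) ^ (J + 1) * (1 - min c₀ (1 / 2)) :=
          mul_le_mul_of_nonneg_left (hscale (J + 1) Λ hΛ x hx) (pow_nonneg hq0 _)
      _ = (1 - min c₀ (1 / 2)) ^ (J + 1 + 1) := by rw [pow_succ _ (J + 1)]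

end Summit.CriticalPhenomena.SAWScalingLimit.Theorems.AvoidanceLimit.Anchor

end
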